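import Literature.MathematicalPhysics.QuantumLattice.OnSitePairingAlgebra
import Literature.MathematicalPhysics.QuantumLattice.QuadraticKKTExactness
import HarnessLib

/-!
# The on-site pairing (BCS/Bogoliubov) block, III: the two Bogoliubov quasiparticle modes

Topic `MathematicalPhysics/QuantumLattice`; continuation of `OnSitePairingAlgebra.lean` (two distinct
orbitals `a ≠ b` of the Jordan–Wigner Fock space `Fock ι`, block Hamiltonian
`h = ξ(n_a + n_b) + Δ(c_b c_a + (c_b c_a)ᴴ)`). For real `u, v` and `E` with the BOGOLIUBOV RELATIONS
`Δ v = (E - ξ) u`, `Δ u = (E + ξ) v` (solvable with `u² + v² = 1` for `E = √(ξ² + Δ²)`,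
`exists_bogoliubov_uv`) the two quasiparticle modes

  `q₁ = u c_a + v c_b†`,   `q₂ = u c_b - v c_a†`

are LOWERING MODES of `h`: `h q₁ - q₁ h = -E q₁`, `h q₂ - q₂ h = -E q₂` (`bdgPair_comm_quasiparticleUp`,
`bdgPair_comm_quasiparticleDown`) — the algebraic content of the Bogoliubov–Valatin diagonalisation
`h = E(q₁†q₁ + q₂†q₂) + (ξ - E)` (Bardeen–Cooper–Schrieffer 1957 §III; Valatin 1958; de Gennes 1966 Ch. 5;
von Delft–Ralph 2001 §4.2). With `u² + v² = 1` they satisfy the CAR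
(`quasiparticle_car_*`: `{q_i, q_j†} = δ_{ij}`, `{q_i, q_j} = 0`) and invert to
`c_a = u q₁ - v q₂†`, `c_b = u q₂ + v q₁†` (`annihilation_eq_quasiparticle_*`). These are the inputs that
`QuadraticKKTExactness.lean` consumes (lowering relations with `E > 0`, scalar anticommutators, one-body
operators in the span of the modes): in every state annihilated by `q₁, q₂` — in particular every state
feasible for their second-order KKT rows — the pair amplitude is `Tr(ρ c_b c_a) = -uv · Tr ρ`
(`trace_pair_of_annihilate`).

Everything is proved from the CAR; no definition and no named fact.

## References
* J. Bardeen, L. N. Cooper, J. R. Schrieffer, Phys. Rev. 108 (1957) 1175, §III.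
* J. G. Valatin, Nuovo Cimento 7 (1958) 843; N. N. Bogoliubov, Nuovo Cimento 7 (1958) 794.
* P. G. de Gennes, *Superconductivity of Metals and Alloys* (1966), Ch. 5. [deGennes1966]
* J. von Delft, D. C. Ralph, Phys. Rep. 345 (2001) 61, §4.2. [VondelftRalph2001]
-/

noncomputable section

namespace Literature.MathematicalPhysics.QuantumLattice

open Matrix Finset HubbardWave0 LiebThm1

section TwoOrbitals

variable {ι : Type*} [LinearOrder ι] [Fintype ι] {a b : ι}

/-! ### Elementary commutators of `N = n_a + n_b` and `S = c_b c_a + (c_b c_a)ᴴ` with the generators -/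

/-- `n_i c_i† = c_i†`. [folklore] -/
private theorem numberAt_mul_creation_self (i : ι) : numberAt i * creation i = creation i := by
  rw [numberAt, mul_assoc, annihilation_mul_creation, if_pos rfl, mul_sub, mul_one, ← mul_assoc,
    creation_mul_self, zero_mul, sub_zero]

/-- `c_i† n_i = 0`. [folklore] -/
private theorem creation_mul_numberAt_self (i : ι) : creation i * numberAt i = 0 := by
  rw [numberAt, ← mul_assoc, creation_mul_self, zero_mul]

/-- `n_i c_j† = c_j† n_i` for `i ≠ j`. [folklore] -/
private theorem numberAt_mul_creation_of_ne {i j : ι} (h : i ≠ j) :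
    numberAt i * creation j = creation j * numberAt i := by
  rw [numberAt]
  exact number_mul_creation_of_ne h

/-- `[n_a + n_b, c_a] = -c_a`. [cite: VondelftRalph2001, §4.2] -/
theorem numberSum_comm_annihilation_left (hab : a ≠ b) :
    (numberAt a + numberAt b) * annihilation a - annihilation a * (numberAt a + numberAt b) =
      -annihilation a := by
  rw [add_mul, mul_add, numberAt_mul_annihilation_self, annihilation_mul_numberAt_self,
    numberAt_mul_annihilation_of_ne hab.symm]
  abel

/-- `[n_a + n_b, c_b] = -c_b`. [cite: VondelftRalph2001, §4.2] -/
theorem numberSum_comm_annihilation_right (hab : a ≠ b) :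
    (numberAt a + numberAt b) * annihilation b - annihilation b * (numberAt a + numberAt b) =
      -annihilation b := by
  rw [add_mul, mul_add, numberAt_mul_annihilation_self, annihilation_mul_numberAt_self,
    numberAt_mul_annihilation_of_ne hab]
  abel

/-- `[n_a + n_b, c_b†] = c_b†`. [cite: VondelftRalph2001, §4.2] -/
theorem numberSum_comm_creation_right (hab : a ≠ b) :
    (numberAt a + numberAt b) * creation b - creation b * (numberAt a + numberAt b) = creation b := by
  rw [add_mul, mul_add, numberAt_mul_creation_self, creation_mul_numberAt_self,
    numberAt_mul_creation_of_ne hab]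
  abel

/-- `[n_a + n_b, c_a†] = c_a†`. [cite: VondelftRalph2001, §4.2] -/
theorem numberSum_comm_creation_left (hab : a ≠ b) :
    (numberAt a + numberAt b) * creation a - creation a * (numberAt a + numberAt b) = creation a := by
  rw [add_mul, mul_add, numberAt_mul_creation_self, creation_mul_numberAt_self,
    numberAt_mul_creation_of_ne hab.symm]
  abel

/-- `[c_b c_a + (c_b c_a)ᴴ, c_a] = -c_b†`. [cite: VondelftRalph2001, §4.2] -/
theorem pairSum_comm_annihilation_left (hab : a ≠ b) :
    (annihilation b * annihilation a + (annihilation b * annihilation a)ᴴ) * annihilation a -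
        annihilation a * (annihilation b * annihilation a + (annihilation b * annihilation a)ᴴ) =
      -creation b := by
  rw [conjTranspose_mul, annihilation_conjTranspose, annihilation_conjTranspose]
  -- `P c_a = 0`, `c_a P = 0`, `c_a†c_b†c_a = -c_a†c_a c_b†`, `c_a c_a†c_b† = c_b† - c_a†c_a c_b†`
  have h1 : annihilation b * annihilation a * annihilation a = 0 := by
    rw [mul_assoc, annihilation_mul_self, mul_zero]
  have h2 : annihilation a * (annihilation b * annihilation a) = 0 := by
    rw [← mul_assoc, annihilation_mul_annihilation_eq_neg a b, neg_mul, mul_assoc, annihilation_mul_self,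
      mul_zero, neg_zero]
  have h3 : creation a * creation b * annihilation a = -(creation a * annihilation a * creation b) := by
    rw [mul_assoc, ← annihilation_conjTranspose, ← annihilation_conjTranspose, show
      (annihilation b)ᴴ * annihilation a = -(annihilation a * (annihilation b)ᴴ) by
        rw [annihilation_conjTranspose, annihilation_mul_creation, if_neg hab, zero_sub, neg_neg],
      mul_neg, mul_assoc]
  have h4 : annihilation a * (creation a * creation b) = creation b - creation a * annihilation a * creation b := by
    rw [← mul_assoc, annihilation_mul_creation, if_pos rfl, sub_mul, one_mul]
  rw [add_mul, mul_add, h1, h2, h3, h4]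
  abel

/-- `[c_b c_a + (c_b c_a)ᴴ, c_b†] = -c_a`. [cite: VondelftRalph2001, §4.2] -/
theorem pairSum_comm_creation_right (hab : a ≠ b) :
    (annihilation b * annihilation a + (annihilation b * annihilation a)ᴴ) * creation b -
        creation b * (annihilation b * annihilation a + (annihilation b * annihilation a)ᴴ) =
      -annihilation a := by
  rw [conjTranspose_mul, annihilation_conjTranspose, annihilation_conjTranspose]
  have h1 : annihilation b * annihilation a * creation b = -(annihilation b * creation b * annihilation a) := by
    rw [mul_assoc, annihilation_mul_creation, if_neg hab, zero_sub, mul_neg, mul_assoc]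
  have h2 : creation b * (annihilation b * annihilation a) = creation b * annihilation b * annihilation a := by
    rw [mul_assoc]
  have h3 : creation a * creation b * creation b = 0 := by rw [mul_assoc, creation_mul_self, mul_zero]
  have h4 : creation b * (creation a * creation b) = 0 := by
    rw [← mul_assoc, creation_mul_creation_eq_neg b a, neg_mul, mul_assoc, creation_mul_self, mul_zero,
      neg_zero]
  have h5 : annihilation b * creation b = 1 - creation b * annihilation b := by
    rw [annihilation_mul_creation, if_pos rfl]
  rw [add_mul, mul_add, h1, h2, h3, h4, h5, sub_mul, one_mul]
  abel

/-- `[c_b c_a + (c_b c_a)ᴴ, c_b] = c_a†`. [cite: VondelftRalph2001, §4.2] -/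
theorem pairSum_comm_annihilation_right (hab : a ≠ b) :
    (annihilation b * annihilation a + (annihilation b * annihilation a)ᴴ) * annihilation b -
        annihilation b * (annihilation b * annihilation a + (annihilation b * annihilation a)ᴴ) =
      creation a := by
  rw [conjTranspose_mul, annihilation_conjTranspose, annihilation_conjTranspose]
  have h1 : annihilation b * annihilation a * annihilation b = 0 := by
    rw [mul_assoc, annihilation_mul_annihilation_eq_neg a b, mul_neg, ← mul_assoc, annihilation_mul_self,
      zero_mul, neg_zero]
  have h2 : annihilation b * (annihilation b * annihilation a) = 0 := by
    rw [← mul_assoc, annihilation_mul_self, zero_mul]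
  have h3 : creation a * creation b * annihilation b = creation a * (creation b * annihilation b) := by
    rw [mul_assoc]
  have h4 : annihilation b * (creation a * creation b) = -(creation a - creation a * (creation b * annihilation b)) := by
    rw [← mul_assoc, annihilation_mul_creation, if_neg hab.symm, zero_sub, neg_mul, mul_assoc,
      annihilation_mul_creation, if_pos rfl, mul_sub, mul_one]
  rw [add_mul, mul_add, h1, h2, h3, h4]
  abel

/-- `[c_b c_a + (c_b c_a)ᴴ, c_a†] = c_b`. [cite: VondelftRalph2001, §4.2] -/
theorem pairSum_comm_creation_left (hab : a ≠ b) :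
    (annihilation b * annihilation a + (annihilation b * annihilation a)ᴴ) * creation a -
        creation a * (annihilation b * annihilation a + (annihilation b * annihilation a)ᴴ) =
      annihilation b := by
  rw [conjTranspose_mul, annihilation_conjTranspose, annihilation_conjTranspose]
  have h1 : annihilation b * annihilation a * creation a = annihilation b - annihilation b * (creation a * annihilation a) := by
    rw [mul_assoc, annihilation_mul_creation, if_pos rfl, mul_sub, mul_one]
  have h2 : creation a * (annihilation b * annihilation a) = -(annihilation b * (creation a * annihilation a)) := by
    rw [← mul_assoc, show creation a * annihilation b = -(annihilation b * creation a) by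
      rw [annihilation_mul_creation, if_neg hab.symm, zero_sub, neg_neg], neg_mul, mul_assoc]
  have h3 : creation a * creation b * creation a = 0 := by
    rw [mul_assoc, creation_mul_creation_eq_neg b a, mul_neg, ← mul_assoc, creation_mul_self, zero_mul,
      neg_zero]
  have h4 : creation a * (creation a * creation b) = 0 := by
    rw [← mul_assoc, creation_mul_self, zero_mul]
  rw [add_mul, mul_add, h1, h2, h3, h4]
  abel

/-! ### The two quasiparticle modes are lowering modes of the block -/

/-- **`[h, q₁] = -E q₁`** for `h = ξ(n_a + n_b) + Δ(c_b c_a + (c_b c_a)ᴴ)` and `q₁ = u c_a + v c_b†`, under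
the Bogoliubov relations `Δv = (E - ξ)u`, `Δu = (E + ξ)v`.
[cite: VondelftRalph2001, §4.2] [cite: deGennes1966, Ch. 5] -/
theorem bdgPair_comm_quasiparticleUp (hab : a ≠ b) {ξ Δ E u v : ℝ} (hu : Δ * v = (E - ξ) * u)
    (hv : Δ * u = (E + ξ) * v) :
    ((ξ : ℂ) • (numberAt a + numberAt b) +
          (Δ : ℂ) • (annihilation b * annihilation a + (annihilation b * annihilation a)ᴴ)) *
        ((u : ℂ) • annihilation a + (v : ℂ) • creation b) -
      ((u : ℂ) • annihilation a + (v : ℂ) • creation b) *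
        ((ξ : ℂ) • (numberAt a + numberAt b) +
          (Δ : ℂ) • (annihilation b * annihilation a + (annihilation b * annihilation a)ᴴ)) =
      -(E : ℂ) • ((u : ℂ) • annihilation a + (v : ℂ) • creation b) := by
  set N : Matrix (Finset ι) (Finset ι) ℂ := numberAt a + numberAt b with hN
  set S : Matrix (Finset ι) (Finset ι) ℂ :=
    annihilation b * annihilation a + (annihilation b * annihilation a)ᴴ with hS
  have e1 := numberSum_comm_annihilation_left hab
  have e2 := numberSum_comm_creation_right hab
  have e3 := pairSum_comm_annihilation_left hab
  have e4 := pairSum_comm_creation_right hab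
  rw [← hN] at e1 e2
  rw [← hS] at e3 e4
  have hexp : ((ξ : ℂ) • N + (Δ : ℂ) • S) * ((u : ℂ) • annihilation a + (v : ℂ) • creation b) -
      ((u : ℂ) • annihilation a + (v : ℂ) • creation b) * ((ξ : ℂ) • N + (Δ : ℂ) • S) =
      (ξ : ℂ) • ((u : ℂ) • (N * annihilation a - annihilation a * N) +
        (v : ℂ) • (N * creation b - creation b * N)) +
      (Δ : ℂ) • ((u : ℂ) • (S * annihilation a - annihilation a * S) +
        (v : ℂ) • (S * creation b - creation b * S)) := by
    simp only [Matrix.smul_mul, Matrix.mul_smul, Matrix.mul_add, Matrix.add_mul, smul_add, smul_sub]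
    module
  rw [hexp, e1, e2, e3, e4]
  have hu' : (Δ : ℂ) * v = ((E : ℂ) - ξ) * u := by exact_mod_cast hu
  have hv' : (Δ : ℂ) * u = ((E : ℂ) + ξ) * v := by exact_mod_cast hv
  match_scalars
  · linear_combination -hu'
  · linear_combination -hv'

/-- **`[h, q₂] = -E q₂`** for `q₂ = u c_b - v c_a†`, under the same Bogoliubov relations.
[cite: VondelftRalph2001, §4.2] [cite: deGennes1966, Ch. 5] -/
theorem bdgPair_comm_quasiparticleDown (hab : a ≠ b) {ξ Δ E u v : ℝ} (hu : Δ * v = (E - ξ) * u)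
    (hv : Δ * u = (E + ξ) * v) :
    ((ξ : ℂ) • (numberAt a + numberAt b) +
          (Δ : ℂ) • (annihilation b * annihilation a + (annihilation b * annihilation a)ᴴ)) *
        ((u : ℂ) • annihilation b - (v : ℂ) • creation a) -
      ((u : ℂ) • annihilation b - (v : ℂ) • creation a) *
        ((ξ : ℂ) • (numberAt a + numberAt b) +
          (Δ : ℂ) • (annihilation b * annihilation a + (annihilation b * annihilation a)ᴴ)) =
      -(E : ℂ) • ((u : ℂ) • annihilation b - (v : ℂ) • creation a) := by
  set N : Matrix (Finset ι) (Finset ι) ℂ := numberAt a + numberAt b with hN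
  set S : Matrix (Finset ι) (Finset ι) ℂ :=
    annihilation b * annihilation a + (annihilation b * annihilation a)ᴴ with hS
  have e1 := numberSum_comm_annihilation_right hab
  have e2 := numberSum_comm_creation_left hab
  have e3 := pairSum_comm_annihilation_right hab
  have e4 := pairSum_comm_creation_left hab
  rw [← hN] at e1 e2
  rw [← hS] at e3 e4
  have hexp : ((ξ : ℂ) • N + (Δ : ℂ) • S) * ((u : ℂ) • annihilation b - (v : ℂ) • creation a) -
      ((u : ℂ) • annihilation b - (v : ℂ) • creation a) * ((ξ : ℂ) • N + (Δ : ℂ) • S) =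
      (ξ : ℂ) • ((u : ℂ) • (N * annihilation b - annihilation b * N) -
        (v : ℂ) • (N * creation a - creation a * N)) +
      (Δ : ℂ) • ((u : ℂ) • (S * annihilation b - annihilation b * S) -
        (v : ℂ) • (S * creation a - creation a * S)) := by
    simp only [Matrix.smul_mul, Matrix.mul_smul, Matrix.mul_sub, Matrix.sub_mul, Matrix.mul_add,
      Matrix.add_mul, smul_add, smul_sub]
    module
  rw [hexp, e1, e2, e3, e4]
  have hu' : (Δ : ℂ) * v = ((E : ℂ) - ξ) * u := by exact_mod_cast hu
  have hv' : (Δ : ℂ) * u = ((E : ℂ) + ξ) * v := by exact_mod_cast hv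
  match_scalars
  · linear_combination -hu'
  · linear_combination hv'

/-! ### Adjoint modes, CAR, and the inverse transformation -/

omit [Fintype ι] in
/-- `q₁ᴴ = u c_a† + v c_b` (real coefficients). [cite: VondelftRalph2001, §4.2] -/
theorem quasiparticleUp_conjTranspose [Fintype ι] (u v : ℝ) :
    ((u : ℂ) • annihilation a + (v : ℂ) • creation b)ᴴ = (u : ℂ) • creation a + (v : ℂ) • annihilation b := by
  rw [conjTranspose_add, conjTranspose_smul, conjTranspose_smul, annihilation_conjTranspose,
    creation_conjTranspose]
  simp only [Complex.star_def, Complex.conj_ofReal]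

omit [Fintype ι] in
/-- `q₂ᴴ = u c_b† - v c_a`. [cite: VondelftRalph2001, §4.2] -/
theorem quasiparticleDown_conjTranspose [Fintype ι] (u v : ℝ) :
    ((u : ℂ) • annihilation b - (v : ℂ) • creation a)ᴴ = (u : ℂ) • creation b - (v : ℂ) • annihilation a := by
  rw [conjTranspose_sub, conjTranspose_smul, conjTranspose_smul, annihilation_conjTranspose,
    creation_conjTranspose]
  simp only [Complex.star_def, Complex.conj_ofReal]

/-- **CAR `{q₁, q₁ᴴ} = 1`** (`u² + v² = 1`). [cite: VondelftRalph2001, §4.2] -/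
theorem quasiparticleUp_car_self {u v : ℝ} (hn : u ^ 2 + v ^ 2 = 1) :
    ((u : ℂ) • annihilation a + (v : ℂ) • creation b) * ((u : ℂ) • annihilation a + (v : ℂ) • creation b)ᴴ +
      ((u : ℂ) • annihilation a + (v : ℂ) • creation b)ᴴ * ((u : ℂ) • annihilation a + (v : ℂ) • creation b) =
      1 := by
  rw [quasiparticleUp_conjTranspose]
  have hexp : ((u : ℂ) • annihilation a + (v : ℂ) • creation b) * ((u : ℂ) • creation a + (v : ℂ) • annihilation b) +
      ((u : ℂ) • creation a + (v : ℂ) • annihilation b) * ((u : ℂ) • annihilation a + (v : ℂ) • creation b) =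
      ((u : ℂ) * u) • (annihilation a * creation a + creation a * annihilation a) +
      ((v : ℂ) * v) • (annihilation b * creation b + creation b * annihilation b) +
      ((u : ℂ) * v) • (annihilation a * annihilation b + annihilation b * annihilation a) +
      ((u : ℂ) * v) • (creation b * creation a + creation a * creation b) := by
    simp only [Matrix.smul_mul, Matrix.mul_smul, Matrix.mul_add, Matrix.add_mul, smul_add]
    module
  have hn' : (u : ℂ) * u + (v : ℂ) * v = 1 := by
    have h := congrArg (fun r : ℝ => (r : ℂ)) hn
    simp only [Complex.ofReal_add, Complex.ofReal_pow, Complex.ofReal_one] at h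
    linear_combination h
  rw [hexp, annihilation_mul_creation_add_creation_mul_annihilation_holds, if_pos rfl,
    annihilation_mul_creation_add_creation_mul_annihilation_holds, if_pos rfl, annihilation_anticommute_holds,
    creation_anticomm]
  simp only [smul_zero, add_zero]
  rw [← add_smul, hn', one_smul]

/-- **CAR `{q₂, q₂ᴴ} = 1`** (`u² + v² = 1`). [cite: VondelftRalph2001, §4.2] -/
theorem quasiparticleDown_car_self {u v : ℝ} (hn : u ^ 2 + v ^ 2 = 1) :
    ((u : ℂ) • annihilation b - (v : ℂ) • creation a) * ((u : ℂ) • annihilation b - (v : ℂ) • creation a)ᴴ +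
      ((u : ℂ) • annihilation b - (v : ℂ) • creation a)ᴴ * ((u : ℂ) • annihilation b - (v : ℂ) • creation a) =
      1 := by
  rw [quasiparticleDown_conjTranspose]
  have hexp : ((u : ℂ) • annihilation b - (v : ℂ) • creation a) * ((u : ℂ) • creation b - (v : ℂ) • annihilation a) +
      ((u : ℂ) • creation b - (v : ℂ) • annihilation a) * ((u : ℂ) • annihilation b - (v : ℂ) • creation a) =
      ((u : ℂ) * u) • (annihilation b * creation b + creation b * annihilation b) +
      ((v : ℂ) * v) • (annihilation a * creation a + creation a * annihilation a) -
      ((u : ℂ) * v) • (annihilation b * annihilation a + annihilation a * annihilation b) -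
      ((u : ℂ) * v) • (creation a * creation b + creation b * creation a) := by
    simp only [Matrix.smul_mul, Matrix.mul_smul, Matrix.mul_sub, Matrix.sub_mul, smul_sub]
    module
  have hn' : (u : ℂ) * u + (v : ℂ) * v = 1 := by
    have h := congrArg (fun r : ℝ => (r : ℂ)) hn
    simp only [Complex.ofReal_add, Complex.ofReal_pow, Complex.ofReal_one] at h
    linear_combination h
  rw [hexp, annihilation_mul_creation_add_creation_mul_annihilation_holds, if_pos rfl,
    annihilation_mul_creation_add_creation_mul_annihilation_holds, if_pos rfl, annihilation_anticommute_holds,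
    creation_anticomm]
  simp only [smul_zero, sub_zero]
  rw [← add_smul, hn', one_smul]

/-- **CAR `{q₁, q₂ᴴ} = 0`** (`a ≠ b`; no normalisation needed). [cite: VondelftRalph2001, §4.2] -/
theorem quasiparticleUp_car_down (hab : a ≠ b) (u v : ℝ) :
    ((u : ℂ) • annihilation a + (v : ℂ) • creation b) * ((u : ℂ) • annihilation b - (v : ℂ) • creation a)ᴴ +
      ((u : ℂ) • annihilation b - (v : ℂ) • creation a)ᴴ * ((u : ℂ) • annihilation a + (v : ℂ) • creation b) =
      0 := by
  rw [quasiparticleDown_conjTranspose]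
  have hexp : ((u : ℂ) • annihilation a + (v : ℂ) • creation b) * ((u : ℂ) • creation b - (v : ℂ) • annihilation a) +
      ((u : ℂ) • creation b - (v : ℂ) • annihilation a) * ((u : ℂ) • annihilation a + (v : ℂ) • creation b) =
      ((u : ℂ) * u - (v : ℂ) * v) • (annihilation a * creation b + creation b * annihilation a) -
      ((u : ℂ) * v) • (annihilation a * annihilation a + annihilation a * annihilation a) +
      ((u : ℂ) * v) • (creation b * creation b + creation b * creation b) := by
    simp only [Matrix.smul_mul, Matrix.mul_smul, Matrix.mul_sub, Matrix.sub_mul, Matrix.mul_add,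
      Matrix.add_mul, smul_sub, smul_add]
    module
  rw [hexp, annihilation_mul_creation_add_creation_mul_annihilation_holds, if_neg hab,
    annihilation_anticommute_holds, creation_anticomm]
  simp only [smul_zero, sub_zero, add_zero]

/-- **CAR `{q₂, q₁ᴴ} = 0`** (adjoint of `quasiparticleUp_car_down`). [cite: VondelftRalph2001, §4.2] -/
theorem quasiparticleDown_car_up (hab : a ≠ b) (u v : ℝ) :
    ((u : ℂ) • annihilation b - (v : ℂ) • creation a) * ((u : ℂ) • annihilation a + (v : ℂ) • creation b)ᴴ +
      ((u : ℂ) • annihilation a + (v : ℂ) • creation b)ᴴ * ((u : ℂ) • annihilation b - (v : ℂ) • creation a) =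
      0 := by
  have h := congrArg conjTranspose (quasiparticleUp_car_down hab u v)
  rw [conjTranspose_add, conjTranspose_mul, conjTranspose_mul, conjTranspose_conjTranspose,
    conjTranspose_zero] at h
  exact h

/-- **Inverse transformation**: `c_a = u q₁ - v q₂ᴴ` (`u² + v² = 1`). [cite: VondelftRalph2001, §4.2] -/
theorem annihilation_eq_quasiparticle_left {u v : ℝ} (hn : u ^ 2 + v ^ 2 = 1) :
    (annihilation a : Matrix (Finset ι) (Finset ι) ℂ) =
      (u : ℂ) • ((u : ℂ) • annihilation a + (v : ℂ) • creation b) -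
        (v : ℂ) • ((u : ℂ) • annihilation b - (v : ℂ) • creation a)ᴴ := by
  rw [quasiparticleDown_conjTranspose]
  have hn' : (u : ℂ) * u + (v : ℂ) * v = 1 := by
    have h := congrArg (fun r : ℝ => (r : ℂ)) hn
    simp only [Complex.ofReal_add, Complex.ofReal_pow, Complex.ofReal_one] at h
    linear_combination h
  symm
  match_scalars
  · linear_combination hn'
  · ring

/-- **Inverse transformation**: `c_b = u q₂ + v q₁ᴴ` (`u² + v² = 1`). [cite: VondelftRalph2001, §4.2] -/
theorem annihilation_eq_quasiparticle_right {u v : ℝ} (hn : u ^ 2 + v ^ 2 = 1) :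
    (annihilation b : Matrix (Finset ι) (Finset ι) ℂ) =
      (u : ℂ) • ((u : ℂ) • annihilation b - (v : ℂ) • creation a) +
        (v : ℂ) • ((u : ℂ) • annihilation a + (v : ℂ) • creation b)ᴴ := by
  rw [quasiparticleUp_conjTranspose]
  have hn' : (u : ℂ) * u + (v : ℂ) * v = 1 := by
    have h := congrArg (fun r : ℝ => (r : ℂ)) hn
    simp only [Complex.ofReal_add, Complex.ofReal_pow, Complex.ofReal_one] at h
    linear_combination h
  symm
  match_scalars
  · linear_combination hn'
  · ring

/-! ### Existence of the Bogoliubov coefficients -/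

omit [LinearOrder ι] [Fintype ι] in
/-- **Bogoliubov coefficients exist**: for `E = √(ξ² + Δ²)` there are real `u, v` with `u² + v² = 1`,
`Δv = (E - ξ)u`, `Δu = (E + ξ)v` (`(u, v) ∝ (Δ, E - ξ)`, or `(1, 0)` / `(0, 1)` when `Δ = 0`).
[cite: VondelftRalph2001, §4.2] [cite: deGennes1966, Ch. 5] -/
theorem exists_bogoliubov_uv (ξ Δ : ℝ) {E : ℝ} (hE : E = Real.sqrt (ξ ^ 2 + Δ ^ 2)) :
    ∃ u v : ℝ, u ^ 2 + v ^ 2 = 1 ∧ Δ * v = (E - ξ) * u ∧ Δ * u = (E + ξ) * v := by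
  have hE2 : E ^ 2 = ξ ^ 2 + Δ ^ 2 := by
    rw [hE, Real.sq_sqrt (by positivity)]
  by_cases hΔ : Δ = 0
  · subst hΔ
    have hEabs : E = |ξ| := by rw [hE]; simp [Real.sqrt_sq_eq_abs]
    rcases le_or_gt 0 ξ with hξ | hξ
    · refine ⟨1, 0, by norm_num, ?_, by simp⟩
      rw [hEabs, abs_of_nonneg hξ]; ring
    · refine ⟨0, 1, by norm_num, by simp, ?_⟩
      rw [hEabs, abs_of_neg hξ]; ring
  · set Nsq : ℝ := Δ ^ 2 + (E - ξ) ^ 2 with hNsq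
    have hNpos : 0 < Nsq := by positivity
    set Nn : ℝ := Real.sqrt Nsq with hNn
    have hNn_pos : 0 < Nn := Real.sqrt_pos.2 hNpos
    have hNn_sq : Nn ^ 2 = Nsq := Real.sq_sqrt hNpos.le
    refine ⟨Δ / Nn, (E - ξ) / Nn, ?_, ?_, ?_⟩
    · rw [div_pow, div_pow, ← add_div, hNn_sq, hNsq, div_self hNpos.ne']
    · ring
    · rw [div_eq_mul_inv, div_eq_mul_inv]
      have : Δ * Δ = (E + ξ) * (E - ξ) := by nlinarith [hE2]
      calc Δ * (Δ * Nn⁻¹) = (Δ * Δ) * Nn⁻¹ := by ring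
        _ = (E + ξ) * (E - ξ) * Nn⁻¹ := by rw [this]
        _ = (E + ξ) * ((E - ξ) * Nn⁻¹) := by ring

/-! ### The pair amplitude in an annihilated state -/

/-- **The pair amplitude is pinned**: if `ρ` is annihilated by both quasiparticle modes
(`q_iρ = 0 = ρq_iᴴ`, e.g. any state feasible for their second-order KKT rows, `annihilate_of_rows`) and
`u² + v² = 1`, `a ≠ b`, then `Tr(ρ c_b c_a) = -uv · Tr ρ` — the quasi-free (BCS) value `-Δ/(2E)`.
[cite: VondelftRalph2001, §4.2] [cite: BachLiebSolovej1994, §2] -/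
theorem trace_pair_of_annihilate (hab : a ≠ b) {u v : ℝ} (hn : u ^ 2 + v ^ 2 = 1)
    {ρ : Matrix (Finset ι) (Finset ι) ℂ}
    (h₁ : ((u : ℂ) • annihilation a + (v : ℂ) • creation b) * ρ = 0 ∧
      ρ * ((u : ℂ) • annihilation a + (v : ℂ) • creation b)ᴴ = 0)
    (h₂ : ((u : ℂ) • annihilation b - (v : ℂ) • creation a) * ρ = 0 ∧
      ρ * ((u : ℂ) • annihilation b - (v : ℂ) • creation a)ᴴ = 0) :
    (ρ * (annihilation b * annihilation a)).trace = -((u : ℂ) * v) * ρ.trace := by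
  -- the family `γ = ![q₁, q₂]` over `Fin 2`
  set γ : Fin 2 → Matrix (Finset ι) (Finset ι) ℂ :=
    ![(u : ℂ) • annihilation a + (v : ℂ) • creation b, (u : ℂ) • annihilation b - (v : ℂ) • creation a] with hγ
  have hann : ∀ k, γ k * ρ = 0 ∧ ρ * (γ k)ᴴ = 0 := by
    intro k; fin_cases k
    · exact h₁
    · exact h₂
  have hcar : ∀ k l : Fin 2, γ k * (γ l)ᴴ + (γ l)ᴴ * γ k = if k = l then 1 else 0 := by
    intro k l; fin_cases k <;> fin_cases l
    · simpa [hγ] using quasiparticleUp_car_self (a := a) (b := b) hn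
    · simpa [hγ] using quasiparticleUp_car_down hab u v
    · simpa [hγ] using quasiparticleDown_car_up hab u v
    · simpa [hγ] using quasiparticleDown_car_self (a := a) (b := b) hn
  -- `c_b = u q₂ + v q₁ᴴ`, `c_a = u q₁ - v q₂ᴴ` as elements of the span
  have hb : (annihilation b : Matrix (Finset ι) (Finset ι) ℂ) =
      ∑ k : Fin 2, ((![0, (u : ℂ)] : Fin 2 → ℂ) k • γ k + (![(v : ℂ), 0] : Fin 2 → ℂ) k • (γ k)ᴴ) := by
    rw [Fin.sum_univ_two]
    simp only [hγ, Matrix.cons_val_zero, Matrix.cons_val_one, zero_smul, zero_add, add_zero]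
    rw [add_comm]
    exact annihilation_eq_quasiparticle_right (a := a) (b := b) hn
  have ha : (annihilation a : Matrix (Finset ι) (Finset ι) ℂ) =
      ∑ k : Fin 2, ((![(u : ℂ), 0] : Fin 2 → ℂ) k • γ k + (![0, -(v : ℂ)] : Fin 2 → ℂ) k • (γ k)ᴴ) := by
    rw [Fin.sum_univ_two]
    simp only [hγ, Matrix.cons_val_zero, Matrix.cons_val_one, zero_smul, add_zero, zero_add, neg_smul]
    rw [← sub_eq_add_neg]
    exact annihilation_eq_quasiparticle_left (a := a) (b := b) hn
  have key := trace_oneBody_mul_oneBody_of_car (ρ := ρ) hann hcar (![0, (u : ℂ)]) (![(v : ℂ), 0])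
    (![(u : ℂ), 0]) (![0, -(v : ℂ)])
  rw [← hb, ← ha] at key
  rw [key]
  simp only [Fin.sum_univ_two, Matrix.cons_val_zero, Matrix.cons_val_one]
  ring

end TwoOrbitals

end Literature.MathematicalPhysics.QuantumLattice
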